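import Summits.NavierStokesRegularity.NavierStokesRegularity.Theorems.ExtremiserTransiencePerFlowScaleLock
import Summits.NavierStokesRegularity.NavierStokesRegularity.Theorems.ExtremiserTransienceBangBangCoreDefs
import Summits.NavierStokesRegularity.NavierStokesRegularity.Theorems.TypeICertificateLadderRungReynoldsOneTaoCover
import Summits.NavierStokesRegularity.NavierStokesRegularity.Theorems.ExtremiserTransienceNearExtremalTransiencePerFlowStubFlowFilamentBudget
import HarnessLib

/-!
# LINE g9-α «filament budget ⊕ chain gap» — crux `NearExtremalTransiencePerFlow` (item stmt-NavierStokesRegularity-26567)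

Route `ExtremiserTransience` (ideator seat ns-idea-5, generation g9, technique card «extremal-example mining»).  HONEST FRAMING:
a crux WORKFILE (KEY-NS #155 (1): files only, not the registered skeleton of record) with TWO registered stubs — F1 now
DISCHARGED BY NAME by the landed theorem `Theorems…FilamentGap.flowFilamentBudget` (prover ns-net-p2 g5, p684070, rev 2), so ONE
`sorry` remains (F2, the heart) — and a kernel-checked composition ending in the crux BY NAME.  Nothing about Navier–Stokes regularity or blow-up is proved here; no summit is proved
by a line.

## Idea (one paragraph)
The g8 instrument (HOME/g8-fields, kit j319252–j320466, float64-certified `κ⋆ ≥ 0.1247`) says the near-maximisers of the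
efficiency `R(v) = |J|/(M√Z√W)` are CROWDS: equal-height cells of Taylor size `λ = √(Z/W)` packed at VOLUME density (`N → box
capacity`, single cell `≈ 0.078`, 3D crowd `≥ 0.1247`, the gain coming from cross-stretching between `λ`-adjacent cells).  A Type-I
flow cannot afford volume-packed crowds: the LOCAL ENERGY INEQUALITY on balls `B(x,r)`, bootstrapped three times through the
Type-I rate `‖u(s)‖_∞ ≤ C√ν/√(T−s)` (crude `M³r²` flux ⇒ `r²/λ` ⇒ `r·log` ⇒ `r`; the pressure enters only through its oscillation,
`∫ p u·∇φ = ∫ (p − c) u·∇φ` by `div u = 0`, with `|∇p_far| ≲ Σ_j (2ʲr)⁻⁴ E(B_{2ʲ⁺¹r})`), gives the FILAMENT BUDGET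
`∫_{B(x,r)} |u(t)|² ≤ A·ν²·r` for ALL `x`, ALL `r > 0` and all late `t` (F1; the scale-invariant local energy `sup_r r⁻¹∫_{B_r}|u|²` of
Caffarelli–Kohn–Nirenberg / Seregin is BOUNDED for sup-norm Type-I flows — a known-type theorem, Seregin–Šverák 2009 §3,
Seregin–Zajaczkowski 2006).  At a near-efficient two-sided-locked late time (LANDED `PerFlow.scaleLock_at_nearEfficient_times`,
with Leray's lower rate `lerayLowerRate_of_not_extends`) one has `(Mλ)² ≥ c₀²c₁ν²`, so in CELL UNITS the slice has LINEAR local energy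
growth `∫_{B(x,r)}|u(t)|² ≤ A'·r·(Mλ)²`, `A' = A/(c₀²c₁)` INDEPENDENT OF `t`: its near-top cells can only be strung along curves
(a 3D-dense cluster of `n` cells has energy `≍ n(Mλ)²λ` in a ball of radius `≍ n^{1/3}λ`, allowed only for `n ≲ A'^{3/2}`; a 2D patch
only for `n ≲ A'²`).  The new slice-level statement is the CHAIN GAP (F2): for every `A`, admissible fields of linear growth `A` are
UNIFORMLY sub-extremal, `|J| ≤ (κ⋆ − ε(A))·M√Z√W`.  F1 ∧ F2 contradict near-efficiency at the locked times: the crux follows for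
every flow, on both the sparse and the crowd branch, without zoom, tangent flow, tube slice or Liouville theorem.

## Stubs (the only `sorry`s; registered names in §2b)
* F1 `stub_flowFilamentBudget` — PROVED (p684070 `flowFilamentBudget`, via the uniform Seregin 2014 Prop 3.11(i) / SS09 L3.5 bound
  `scaledEnergies_bounded_of_typeIRate_unif`, p682869). Was: flow side, provable-grade (L): bounded scale-invariant local energy for sup-norm Type-I classical
  Leray–Hopf flows (three-pass bootstrap of the local energy inequality; small scales by the sup bound, macroscopic scales by `E₀`).
* F2 `stub_chainGap` — THE OPEN HEART, slice-level pure analysis: the linear-growth class is uniformly sub-extremal.  Equivalent to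
  «`A(v_n) → ∞` along every maximising sequence of `R`», `A(v) = sup_{x,r>0} ∫_{B(x,r)}|v|²/(r(Mλ)²)`; it IMPLIES `¬KStarAttained` (item 24370:
  an extremiser `w⋆` would have `A(w⋆) < ∞`) — the bet is the g8 reading (P2) «crowd supremum, no attainment»; it is refuted by any
  attainment proof or by the chain instrument (card §falsifier: x-periodic chains of bounded cross-section reaching the 3D crowd value).
Composition `NearExtremalTransiencePerFlow_of (h1 : Registered.stub_flowFilamentBudget) (h2 : Registered.stub_chainGap) :
NearExtremalTransiencePerFlow` (no sorry), over the landed two-sided scale lock, Leray's lower rate and the Tao-class cover.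

## Why novel vs the listed lines (same-wall test)
α/S-E (sparse bang-bang) needs SPARSE efficient times and is silent on crowds; β (analytic gap) needs S-E; γ/g6 (bang-bang core,
28317) and 27676 ask δ-uniform near-plateaus, disfavoured by the g8 cell shape; δ (member selection) zooms to a tangent Type-I ancient
field and needs the single-slice Liouville-type heart T3 `NoTubeSlice` / item 27695.  None uses the flow's ENERGY at all scales: the
filament budget is the first lever on this crux that is (i) a known-type flow theorem, (ii) scale-invariant, (iii) incompatible with the
measured geometry of near-maximisers (volume-packed crowds), and it turns the crowd wall into a VARIATIONAL gap statement about one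
functional on an explicit class (linear growth), decidable by the seat's own instrument.

## Bears on · falsifier · instrument
bears_on: LADDER-NS rung K-a / route ExtremiserTransience crux 26567 (deciding; both branches).  Cheapest falsifier of F2: an x-periodic
CHAIN of cells (period `a`, cross-section `≤ s·λ`, `s = 1,2,3`) whose per-period efficiency reaches the 3D periodic-crowd value `0.1247`
(g8 engine `freeform_g8.py` in a long thin box; PREREG in the card) — a chain value `≥ 0.1247` kills the line numerically, a chain ceiling
well below it (nearest-neighbour count predicts `≈ 0.086`) is the instrument row supporting F2.  Falsifier of F1: none expected (theorem-type);
a Type-I classical flow with `r⁻¹∫_{B_r}|u(t)|² → ∞` at some scale `λ(t) ≤ r ≤ R` would refute it and Seregin–Šverák's bounded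
scaled energy with it.
-/

noncomputable section

open scoped Topology InnerProductSpace RealInnerProductSpace ENNReal ContDiff
open MeasureTheory Filter Set Metric
open Literature.Analysis.FluidPDE
open Summit.NavierStokesRegularity.NavierStokesRegularity.Theses.ExtremiserTransience
open Summit.NavierStokesRegularity.NavierStokesRegularity.Theorems
open Summit.NavierStokesRegularity.NavierStokesRegularity.Theorems.DepletionLadder.KStar.HalfSpace
open Summit.NavierStokesRegularity.NavierStokesRegularity.Theorems.DepletionLadder.KStar.BangBang

namespace Summit.NavierStokesRegularity.NavierStokesRegularity.Cruxes.NearExtremalTransiencePerFlow.FilamentGap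

set_option linter.dupNamespace false
set_option linter.unusedVariables false
set_option linter.style.longLine false

/-! ## §0 Vocabulary (over the tree's `KStar.HalfSpace.{E3, kStar, Jst, Zen, Wpa}` and `KStar.BangBang.{lam, IsAdm}`) -/

/-- LINEAR LOCAL ENERGY GROWTH IN CELL UNITS at rate `A`: every ball of radius `r > 0` carries energy at most `A · r · (M·λ(v))²`
(`λ(v) = √(Z/W)` the Taylor length, `M` the height bound).  Every admissible field has it for SOME `A` (`A ≥ 4π/3` covers `r ≤ λ`,
`A ≥ E/(M²λ³)` covers `r ≥ λ`); a 3D-dense crowd of `n` cells violates it once `n ≳ A^{3/2}`, a 2D patch once `n ≳ A²`: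
at fixed `A` only chains (necklaces) of bounded cross-section are unbounded. -/
def IsLinGrowth (A : ℝ) (v : E3 → E3) (M : ℝ) : Prop :=
  ∀ (x : E3) (r : ℝ), 0 < r → ∫ y in Metric.ball x r, ‖v y‖ ^ 2 ≤ A * r * (M * lam v) ^ 2

/-! ## §1 The two statements of the line -/

/-- (F1 — provable-grade, flow side) FILAMENT BUDGET: a classical solution on `[0,T) × ℝ³` from rapidly decaying Leray–Hopf data with
eventual Type-I rate `√(T−t)‖u(t)‖_∞ ≤ C√ν` has, for some `A` and all late `t`, `∫_{B(x,r)}|u(t)|² ≤ A·ν²·r` for EVERY centre `x` and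
EVERY radius `r > 0` (bounded scale-invariant local energy `sup_{x,r} r⁻¹∫_{B(x,r)}|u(t)|²`; small `r` by the sup bound, large `r` by the
energy, the parabolic range by the three-pass bootstrap of the local energy inequality). Seregin–Šverák 2009 §3, Seregin–Zajaczkowski 2006,
CKN 1982. -/
def FlowFilamentBudget : Prop :=
  ∀ (C ν T : ℝ), 0 < C → 0 < ν → 0 < T → ∀ (u : ℝ → E3 → E3) (p : ℝ → E3 → ℝ),
    IsClassicalNSSolutionOn (Set.Ico 0 T) ν 0 u p → IsLerayHopfOn T ν 0 (u 0) u → HasRapidSpatialDecay (u 0) →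
    (∀ᶠ t in 𝓝[<] T, ∀ x, Real.sqrt (T - t) * ‖u t x‖ ≤ C * Real.sqrt ν) →
    ∃ A : ℝ, ∀ᶠ t in 𝓝[<] T, ∀ (x : E3) (r : ℝ), 0 < r → ∫ y in Metric.ball x r, ‖u t y‖ ^ 2 ≤ A * ν ^ 2 * r

/-- (F2 — THE OPEN HEART, slice level) CHAIN GAP: for every growth rate `A` there is `ε > 0` such that every admissible non-degenerate
field with linear local energy growth `A` in cell units is `ε`-sub-extremal: `|J| ≤ (κ⋆ − ε)·M·√Z·√W`.  Equivalently the growth constant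
`A(v_n) → ∞` along every maximising sequence of the efficiency; implies `¬KStarAttained`; suggested by the g8 instrument (near-maximisers
are volume-packed crowds, `N → capacity`); refutable by the chain instrument of the card. -/
def ChainGap : Prop :=
  ∀ A : ℝ, ∃ ε : ℝ, 0 < ε ∧ ∀ (v : E3 → E3) (M B : ℝ), IsAdm v M B → IsLinGrowth A v M →
    0 < M * Real.sqrt (Zen v) * Real.sqrt (Wpa v) →
    |Jst v| ≤ (kStar - ε) * M * Real.sqrt (Zen v) * Real.sqrt (Wpa v)

/-! ## §2 Registered stubs (the only `sorry`s) -/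

/-- F1 (flow side; bounded scale-invariant local energy under the Type-I rate). -/
/- F1 is now a THEOREM of the tree (prover ns-net-p2 g5, p684070, 2026-08-29): the stub is discharged by name. -/
theorem stub_flowFilamentBudget : FlowFilamentBudget :=
  Summit.NavierStokesRegularity.NavierStokesRegularity.Theorems.NearExtremalTransiencePerFlow.FilamentGap.flowFilamentBudget

/-- F2 (open heart; the linear-growth class is uniformly sub-extremal). -/
theorem stub_chainGap : ChainGap := by
  sorry

/-! ## §2b Registration block (the composition's hypotheses are these names) -/

namespace Registered

/-- registered stub F1 -/
abbrev stub_flowFilamentBudget : Prop := FlowFilamentBudget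
/-- registered stub F2 -/
abbrev stub_chainGap : Prop := ChainGap

end Registered

theorem stub_flowFilamentBudget_holds : Registered.stub_flowFilamentBudget := stub_flowFilamentBudget
theorem stub_chainGap_holds : Registered.stub_chainGap := stub_chainGap

/-! ## §3 Composition (kernel-checked, no `sorry`): F1 → F2 → the crux BY NAME -/

/-- **LINE g9-α.**  At a `(κ⋆ − ε/2)`-efficient two-sided-locked late time (landed `PerFlow.scaleLock_at_nearEfficient_times`) the slice is
admissible (Tao-class cover for the `L²` clause), non-degenerate, and — by F1, Leray's lower rate and the lower lock, `(Mλ)² ≥ c₀²c₁ν²` —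
of linear growth `max A 0/(c₀²c₁)` in cell units; F2 caps its efficiency at `κ⋆ − ε`: contradiction. -/
theorem NearExtremalTransiencePerFlow_of (h1 : Registered.stub_flowFilamentBudget) (h2 : Registered.stub_chainGap) :
    NearExtremalTransiencePerFlow := by
  have hF1 : FlowFilamentBudget := h1
  have hF2 : ChainGap := h2
  intro C ν T hC hν hT u p hsol hLH hdec hrate hsing
  by_contra hno
  -- F1: the filament budget past some onset `a < T`
  obtain ⟨A, hA⟩ := hF1 C ν T hC hν hT u p hsol hLH hdec hrate
  obtain ⟨a, haT, hsub⟩ := mem_nhdsLT_iff_exists_Ioo_subset.1 hA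
  have haT' : a < T := haT
  -- the landed two-sided scale lock at near-efficient late times, and Leray's lower rate
  obtain ⟨c₁, c₂, hc₁, hc₁₂, hlock⟩ :=
    DepletionLadder.PerFlow.scaleLock_at_nearEfficient_times hC hν hT hsol hLH hdec hrate hsing hno
  obtain ⟨c₀, hc₀, hleray⟩ := DepletionLadder.PerFlow.lerayLowerRate_of_not_extends hν hT hsol hLH hdec hsing
  -- F2 at the flow's growth constant in cell units
  have hden : 0 < c₀ ^ 2 * c₁ := by positivity
  obtain ⟨ε, hε, hgap⟩ := hF2 (max A 0 / (c₀ ^ 2 * c₁))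
  -- a locked, `(κ⋆ − ε/2)`-efficient time past the onset
  set t₁ : ℝ := max 0 ((a + T) / 2) with ht₁def
  have ht₁ : t₁ ∈ Set.Ico 0 T := ⟨le_max_left _ _, max_lt hT (by linarith)⟩
  have hε2 : 0 < ε / 2 := by positivity
  obtain ⟨t, ht⟩ := MeasureTheory.nonempty_of_measure_ne_zero (hlock (ε / 2) hε2 t₁ ht₁)
  simp only [Set.mem_setOf_eq] at ht
  obtain ⟨htI, hZlo, hZhi, hcd, hdiv, ⟨B, hB⟩, hH1, hH2, M, hM, hpos, heff⟩ := ht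
  have ht0 : 0 ≤ t := ht₁.1.trans htI.1
  have htT : t < T := htI.2
  have hat : a < t := lt_of_lt_of_le (lt_of_lt_of_le (by linarith) (le_max_right 0 ((a + T) / 2))) htI.1
  have hTt : 0 < T - t := sub_pos.2 htT
  -- translate the literal integrals into the `KStar.HalfSpace` vocabulary
  have hpos' : 0 < M * Real.sqrt (Zen (u t)) * Real.sqrt (Wpa (u t)) := hpos
  have hZlo' : c₁ * (ν * (T - t)) * Wpa (u t) ≤ Zen (u t) := hZlo
  have heff' : (kStar - ε / 2) * M * Real.sqrt (Zen (u t)) * Real.sqrt (Wpa (u t)) ≤ |Jst (u t)| := by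
    unfold kStar udcSet Zen Wpa Jst
    exact heff
  -- the `L²` clause of admissibility (Tao-class cover of the closed sub-slab `[0,(t+T)/2]`)
  have ht' : (t + T) / 2 ∈ Set.Ioo 0 T := ⟨by linarith, by linarith⟩
  obtain ⟨q, hsolt, hut, -, -⟩ := RungReynoldsOne.stub_taoCover hν hT hsol hLH hdec ht'
  obtain ⟨C₀, hC₀⟩ := hut 0
  have htIcc : t ∈ Set.Icc 0 ((t + T) / 2) := ⟨ht0, by linarith⟩
  have hH0 : ∫⁻ x, ‖iteratedFDeriv ℝ 0 (u t) x‖ₑ ^ 2 < ⊤ := (hC₀ t htIcc).trans_lt ENNReal.coe_lt_top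
  have hadm : IsAdm (u t) M B := ⟨hcd, hdiv, hM, hB, hH0, hH1, hH2⟩
  -- positivity bookkeeping: `W > 0`, `Z ≥ 0`, `M² (T−t) ≥ c₀² ν`
  have hsW : 0 < Real.sqrt (Wpa (u t)) := by
    rcases (Real.sqrt_nonneg (Wpa (u t))).lt_or_eq with h | h
    · exact h
    · exfalso
      rw [← h, mul_zero] at hpos'
      exact lt_irrefl _ hpos'
  have hW : 0 < Wpa (u t) := Real.sqrt_pos.1 hsW
  have hZ0 : 0 ≤ Zen (u t) := by
    unfold Zen
    exact integral_nonneg fun x => by positivity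
  have hM0 : 0 ≤ M := le_trans (norm_nonneg _) (hM 0)
  obtain ⟨x₀, hx₀⟩ := hleray t ⟨ht0, htT⟩
  have hMrate : c₀ * Real.sqrt ν ≤ Real.sqrt (T - t) * M :=
    hx₀.trans (mul_le_mul_of_nonneg_left (hM x₀) (Real.sqrt_nonneg _))
  have hMsq : c₀ ^ 2 * ν ≤ (T - t) * M ^ 2 := by
    have h := pow_le_pow_left₀ (by positivity) hMrate 2
    rw [mul_pow, mul_pow, Real.sq_sqrt hν.le, Real.sq_sqrt hTt.le] at h
    exact h
  -- `(Mλ)² ≥ c₀² c₁ ν²`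
  have hkey : c₀ ^ 2 * c₁ * ν ^ 2 ≤ (M * lam (u t)) ^ 2 := by
    have hlam2 : (M * lam (u t)) ^ 2 = M ^ 2 * (Zen (u t) / Wpa (u t)) := by
      unfold lam
      rw [mul_pow, Real.sq_sqrt (div_nonneg hZ0 hW.le)]
    rw [hlam2]
    have hratio : c₁ * (ν * (T - t)) ≤ Zen (u t) / Wpa (u t) := by
      rw [le_div_iff₀ hW]
      exact hZlo'
    calc c₀ ^ 2 * c₁ * ν ^ 2 = c₁ * ν * (c₀ ^ 2 * ν) := by ring
      _ ≤ c₁ * ν * ((T - t) * M ^ 2) := by gcongr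
      _ = M ^ 2 * (c₁ * (ν * (T - t))) := by ring
      _ ≤ M ^ 2 * (Zen (u t) / Wpa (u t)) := by gcongr
  -- linear growth in cell units
  have hmem : t ∈ {t : ℝ | ∀ (x : E3) (r : ℝ), 0 < r → ∫ y in Metric.ball x r, ‖u t y‖ ^ 2 ≤ A * ν ^ 2 * r} :=
    hsub ⟨hat, htT⟩
  simp only [Set.mem_setOf_eq] at hmem
  have hgrowth : IsLinGrowth (max A 0 / (c₀ ^ 2 * c₁)) (u t) M := by
    intro x r hr
    have hA0 : 0 ≤ max A 0 := le_max_right _ _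
    calc ∫ y in Metric.ball x r, ‖u t y‖ ^ 2 ≤ A * ν ^ 2 * r := hmem x r hr
      _ ≤ max A 0 * ν ^ 2 * r := by gcongr; exact le_max_left _ _
      _ = max A 0 / (c₀ ^ 2 * c₁) * r * (c₀ ^ 2 * c₁ * ν ^ 2) := by
          field_simp
      _ ≤ max A 0 / (c₀ ^ 2 * c₁) * r * (M * lam (u t)) ^ 2 := by gcongr
  -- F2 caps the efficiency at `κ⋆ − ε`; the time is `(κ⋆ − ε/2)`-efficient: contradiction
  have hJle := hgap (u t) M B hadm hgrowth hpos'
  nlinarith [hJle, heff', mul_pos hε hpos']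

end Summit.NavierStokesRegularity.NavierStokesRegularity.Cruxes.NearExtremalTransiencePerFlow.FilamentGap

end
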